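import Summits.BirchSwinnertonDyer.BirchSwinnertonDyer.Theorems.CumulativeHeegnerLeopoldtCumulativeHeegnerInclusionAtThreeLayerControlDualKernel
import Literature.RingTheory.FittingIdeal.FittingLemma
import HarnessLib

/-!
# Crux K1 `CumulativeHeegnerInclusionAtThree` (stmt-BirchSwinnertonDyer-24198) / crux A (stmt-26896): the
# port [P-ctl], VII — Fitting transfer through a surjection with ANNIHILATED kernel:
# `d · ker(M ↠ N) = 0`, `M` generated by `G` elements ⟹ `d^G · Fitt₀(N) ⊆ Fitt₀(M)`; hence for K1's `Σ = ∅`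
# `p^{aG} · Fitt_Λ(Hom(Sel_𝔭(K_n), ℚ/ℤ)) ⊆ Fitt_Λ(X) + (ω_n)` as soon as `p^a · coker s_n = 0`, with `G` UNIFORM in `n`

Width seat bsd-line-chl-k1-p1-w8 (`--supports stmt-BirchSwinnertonDyer-24198`). THEOREMS ONLY (no definition, no named
fact, no `sorry`); ROUTE-INDEPENDENT. The (LT) consumer `…LayerTowerControl.forall_pow_mul_mem_map_fittingIdeal_sup_layer`
(p637962) needs layer data `C_m → X ⧸ ω_m X → N_m → 0` with `C_m` killed by `p^a` AND generated by `g` elements, `(a, g)` uniform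
in `m`. For K1's own `Σ = ∅`, `C_m = ker q_m ≅ Hom(coker s_m, ℚ/ℤ)` (VI) and a uniform generator count would need the ORDER of
`coker s_m` along the tower. This file removes the generator count from the requirements: the number of generators that
matters is that of `X` itself (finitely generated, fixed), not of `C_m`.

* §1 `span_pow_mul_fittingIdeal_le_of_surjective` (any commutative ring): for `g : M ↠ N` with `d · ker g = 0` and `M`
  generated by `x₁ … x_G`: `d^G · Fitt₀(N) ⊆ Fitt₀(M)` (Fitting's lemma: compute `Fitt₀(N)` on the images `g xᵢ`; a
  `G × G` relation matrix `ρ` of the `g xᵢ` gives the relation matrix `d·ρ` of the `xᵢ`, `det(dρ) = d^G det ρ`).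
* §2 `span_pow_mul_fittingIdeal_layer_le_sup` (generic `E/K`, `p`, `κ`, `𝔭`, `Σ`, layer `n`): for any dual layer map `q_n`
  (IV) which is onto and whose kernel is killed by `p^a`, and any generating family of `X_ac^Σ` of size `G`:
  `p^{aG} · Fitt_Λ(Hom(Sel_𝔭^Σ(K_n, E[p^∞]), ℚ/ℤ)) ⊆ Fitt_Λ(X_ac^Σ) + (ω_n)`; `mem_map_fittingIdeal_sup_of_annihilator` — the
  transported one-layer (LT) step: `θ ∈ Fitt(N_n)·R`, `t·L ∈ (θ) + 𝔟`, `φ ω_n ∈ 𝔟` ⟹ `φ(p^{aG})·t·L ∈ Fitt(X)·R + 𝔟`.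
  With VI (`p^a · coker s_n = 0 ⟹ p^a · ker q_n = 0`) the only remaining input for `Σ = ∅` is an `n`-UNIFORM annihilator
  `p^a` of `coker s_n` — Greenberg's Lemma 3.3 (bad places, bounded order along the tower).

Crux A (26896) and K1 (24198) stay OPEN; BSD is not proved by any of this; no summit statement is proved by this seat.

References: [StacksProject] Tags 07Z8 (Fitting's lemma), 07ZA; [Eisenbud1995] §20.2, Cor. 20.4; [MazurTate1987] §1;
[GreenbergLNM1716] §3 Lemma 3.3 and p. 90.
-/

set_option linter.dupNamespace false
set_option autoImplicit false

noncomputable section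

open scoped Classical

namespace Summit.BirchSwinnertonDyer.BirchSwinnertonDyer.Theorems.CumulativeHeegnerInclusionAtThreeLayerControlFittingTransfer

open Literature.RingTheory.FittingIdeal

/-! ## §1 `d · ker(M ↠ N) = 0`, `M` generated by `G` elements ⟹ `d^G · Fitt₀(N) ⊆ Fitt₀(M)` -/

section Algebra

variable {R : Type*} [CommRing R] {M N : Type*} [AddCommGroup M] [Module R M] [AddCommGroup N] [Module R N]

/-- The images of a generating family generate the target of a surjection. [folklore] -/
theorem span_range_comp_eq_top (g : M →ₗ[R] N) (hg : Function.Surjective g) {G : ℕ} (x : Fin G → M)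
    (hx : Submodule.span R (Set.range x) = ⊤) : Submodule.span R (Set.range (g ∘ x)) = ⊤ := by
  rw [Set.range_comp, Submodule.span_image, hx, Submodule.map_top, LinearMap.range_eq_top.mpr hg]

/-- **Fitting transfer through a surjection with annihilated kernel.** If `g : M → N` is onto, `d` kills `ker g`,
and `M` is generated by `G` elements `x₁, …, x_G`, then `d^G · Fitt₀(N) ⊆ Fitt₀(M)`: by Fitting's lemma
(`Module.fittingIdeal_eq_relMinorIdeal`) `Fitt₀(N)` is generated by the determinants of the `G × G` relation matrices
`ρ` among the `g xᵢ`; each row `ρᵢ` has `∑ ρᵢₗ xₗ ∈ ker g`, so `d·ρ` is a relation matrix among the `xᵢ` and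
`det(d ρ) = d^G det ρ ∈ Fitt₀(M)`. (Compare Stacks 07ZA (4), which needs a generator count for the KERNEL; here the
count is that of `M`.) [cite: StacksProject, Tag 07Z8 and Tag 07ZA] [cite: Eisenbud1995, Cor. 20.4] -/
theorem span_pow_mul_fittingIdeal_le_of_surjective (g : M →ₗ[R] N) (hg : Function.Surjective g) {G : ℕ}
    (x : Fin G → M) (hx : Submodule.span R (Set.range x) = ⊤) {d : R}
    (hd : ∀ m : M, g m = 0 → d • m = 0) :
    Ideal.span {d ^ G} * Module.fittingIdeal R N 0 ≤ Module.fittingIdeal R M 0 := by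
  have hgx := span_range_comp_eq_top g hg x hx
  rw [Module.fittingIdeal_eq_relMinorIdeal (g ∘ x) hgx 0, Module.fittingIdeal_eq_relMinorIdeal x hx 0,
    Nat.sub_zero, Ideal.span_singleton_mul_le_iff]
  intro z hz
  induction hz using Submodule.span_induction with
  | mem s hs =>
    obtain ⟨ρ, σ, hρ, rfl⟩ := hs
    -- `d • ρ` is a relation matrix among the `xᵢ`
    have hρ' : ∀ i, ∑ l, (d * ρ i l) • x l = 0 := fun i ↦ by
      have h1 : g (∑ l, ρ i l • x l) = 0 := by
        rw [map_sum]
        simpa only [map_smul, Function.comp_apply] using hρ i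
      have h2 := hd _ h1
      rw [Finset.smul_sum] at h2
      simpa only [smul_smul] using h2
    have hmem := Module.det_mem_relMinorIdeal x (fun i l ↦ d * ρ i l) hρ' σ
    have e : (Matrix.of fun i i' ↦ d * ρ i (σ i')) = d • Matrix.of fun i i' ↦ ρ i (σ i') := by
      ext i i'
      simp only [Matrix.of_apply, Matrix.smul_apply, smul_eq_mul]
    rw [e, Matrix.det_smul, Fintype.card_fin] at hmem
    exact hmem
  | zero => rw [mul_zero]; exact Ideal.zero_mem _
  | add a b _ _ ha hb => rw [mul_add]; exact Ideal.add_mem _ ha hb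
  | smul a b _ hb =>
    rw [smul_eq_mul, mul_left_comm]
    exact Ideal.mul_mem_left _ a hb

/-- Quotient form: `d` kills `ker (M ⧸ P ↠ N)` and `M` is generated by `G` elements ⟹
`d^G · Fitt₀(N) ⊆ Fitt₀(M ⧸ P)` (the images of the generators generate the quotient). [cite: StacksProject, Tag 07ZA] -/
theorem span_pow_mul_fittingIdeal_le_quotient (P : Submodule R M) (q : (M ⧸ P) →ₗ[R] N)
    (hq : Function.Surjective q) {G : ℕ} (x : Fin G → M) (hx : Submodule.span R (Set.range x) = ⊤) {d : R}
    (hd : ∀ z : M ⧸ P, q z = 0 → d • z = 0) :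
    Ideal.span {d ^ G} * Module.fittingIdeal R N 0 ≤ Module.fittingIdeal R (M ⧸ P) 0 :=
  span_pow_mul_fittingIdeal_le_of_surjective q hq (P.mkQ ∘ x)
    (span_range_comp_eq_top P.mkQ (Submodule.mkQ_surjective P) x hx) hd

end Algebra

/-! ## §2 The layer: `p^{aG} · Fitt_Λ(Hom(Sel_𝔭^Σ(K_n), ℚ/ℤ)) ⊆ Fitt_Λ(X_ac^Σ) + (ω_n)` -/

section Layer

open NumberField IsDedekindDomain Field
open Literature.NumberTheory.EllipticCurves Literature.NumberTheory.EllipticCurves.GreenbergSelmer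
open Literature.NumberTheory.EllipticCurves.IwasawaDual
open Literature.NumberTheory.GaloisRepresentations
open Summit.BirchSwinnertonDyer.Rank1Residual.X11b Summit.BirchSwinnertonDyer.Rank1Residual.X11b.AcSelmer
open Summit.BirchSwinnertonDyer.BirchSwinnertonDyer.Theorems.BiquadraticEisensteinDescentDefs
open Summit.BirchSwinnertonDyer.BirchSwinnertonDyer.Theorems.CumulativeHeegnerInclusionAtThreeLayerControlDualKernel

variable {K : Type} [Field K] [NumberField K] {p : ℕ} [Fact p.Prime] (κ : ZpExtension K p)
  (W : WeierstrassCurve K) (𝔭 : HeightOneSpectrum (𝓞 K)) (S : Set (HeightOneSpectrum (𝓞 K)))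
  (γ : absoluteGaloisGroup K) [hγ : Fact (κ.IsTopGenerator γ)] (n : ℕ)

/-- **One layer, `Σ` arbitrary (in particular `∅`): `p^{aG} · Fitt_Λ(Hom(Sel_𝔭^Σ(K_n, E[p^∞]), ℚ/ℤ)) ⊆ Fitt_Λ(X_ac^Σ) + (ω_n)`.**
For any dual layer map `q_n : X ⧸ ω_n X → LocNilDual Sel_n f h` (IV) which is ONTO and whose kernel is killed by `p^a`
(VI: as soon as `p^a · coker s_n = 0`), and any generating family of `X = X_ac^Σ` of size `G`: §1 through `X ↠ X ⧸ ω_n X ↠ N_n`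
and `Fitt₀(X ⧸ ω_n X) ⊆ Fitt₀(X) + (ω_n)` (tree `BoundedCongruenceLimit.fittingIdeal_quotient_le_sup`). The exponent
`a·G` is UNIFORM in `n` when `a` is. [cite: StacksProject, Tag 07ZA] [cite: MazurTate1987, §1] [cite: GreenbergLNM1716, §3 p. 90] -/
theorem span_pow_mul_fittingIdeal_layer_le_sup [Module.Finite (IwasawaAlgebra p) (XAc W p κ 𝔭 S γ)]
    {f : AddMonoid.End ↥(selmerOver (κ.layerSubgroup n) (W.geomPrimaryTorsion p) p 𝔭 S)}
    {h : IsLocNil p (f - 1)}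
    (q : (XAc W p κ 𝔭 S γ ⧸ (Ideal.span {((1 + PowerSeries.X : IwasawaAlgebra p) ^ (p ^ n) - 1)} •
        (⊤ : Submodule (IwasawaAlgebra p) (XAc W p κ 𝔭 S γ)))) →ₗ[IwasawaAlgebra p]
        LocNilDual (selmerOver (κ.layerSubgroup n) (W.geomPrimaryTorsion p) p 𝔭 S) f h)
    (hqsurj : Function.Surjective q) {a : ℕ}
    (hann : ∀ z, q z = 0 → p ^ a • z = 0)
    {G : ℕ} (x : Fin G → XAc W p κ 𝔭 S γ) (hx : Submodule.span (IwasawaAlgebra p) (Set.range x) = ⊤) :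
    Ideal.span {((p : IwasawaAlgebra p) ^ a) ^ G} *
        Module.fittingIdeal (IwasawaAlgebra p)
          (LocNilDual (selmerOver (κ.layerSubgroup n) (W.geomPrimaryTorsion p) p 𝔭 S) f h) 0 ≤
      Module.fittingIdeal (IwasawaAlgebra p) (XAc W p κ 𝔭 S γ) 0 ⊔
        Ideal.span {((1 + PowerSeries.X : IwasawaAlgebra p) ^ (p ^ n) - 1)} := by
  have hd : ∀ z : XAc W p κ 𝔭 S γ ⧸ (Ideal.span {((1 + PowerSeries.X : IwasawaAlgebra p) ^ (p ^ n) - 1)} •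
      (⊤ : Submodule (IwasawaAlgebra p) (XAc W p κ 𝔭 S γ))), q z = 0 → ((p : IwasawaAlgebra p) ^ a) • z = 0 :=
    fun z hz ↦ by rw [← Nat.cast_pow, Nat.cast_smul_eq_nsmul]; exact hann z hz
  exact (span_pow_mul_fittingIdeal_le_quotient _ q hqsurj x hx hd).trans
    (Summit.BirchSwinnertonDyer.BirchSwinnertonDyer.Theorems.BoundedCongruenceLimit.fittingIdeal_quotient_le_sup
      (Ideal.span {((1 + PowerSeries.X : IwasawaAlgebra p) ^ (p ^ n) - 1)}) (XAc W p κ 𝔭 S γ) 0)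

/-- **The transported one-layer (LT) step with an annihilator instead of exact control.** Along any ring map
`φ : Λ → R` (intended `toUnr`), with an error ideal `𝔟 ∋ φ ω_n`: if `q_n` is onto with kernel killed by `p^a`, `X` is generated
by `G` elements, `θ ∈ Fitt_Λ(Hom(Sel_𝔭^Σ(K_n), ℚ/ℤ))·R` and `t·L ∈ (θ) + 𝔟`, then `φ(p^{aG})·t·L ∈ Fitt_Λ(X_ac^Σ)·R + 𝔟` AND
`∈ Fitt_Λ(X_ac^∅)·R + 𝔟` — the layer-`n` clause of (LT) with the `n`-uniform extra exponent `a·G`. [cite: MazurTate1987, §1]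
[cite: StacksProject, Tag 07ZA] -/
theorem mem_map_fittingIdeal_sup_of_annihilator [Module.Finite (IwasawaAlgebra p) (XAc W p κ 𝔭 S γ)]
    {f : AddMonoid.End ↥(selmerOver (κ.layerSubgroup n) (W.geomPrimaryTorsion p) p 𝔭 S)}
    {h : IsLocNil p (f - 1)}
    (q : (XAc W p κ 𝔭 S γ ⧸ (Ideal.span {((1 + PowerSeries.X : IwasawaAlgebra p) ^ (p ^ n) - 1)} •
        (⊤ : Submodule (IwasawaAlgebra p) (XAc W p κ 𝔭 S γ)))) →ₗ[IwasawaAlgebra p]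
        LocNilDual (selmerOver (κ.layerSubgroup n) (W.geomPrimaryTorsion p) p 𝔭 S) f h)
    (hqsurj : Function.Surjective q) {a : ℕ}
    (hann : ∀ z, q z = 0 → p ^ a • z = 0)
    {G : ℕ} (x : Fin G → XAc W p κ 𝔭 S γ) (hx : Submodule.span (IwasawaAlgebra p) (Set.range x) = ⊤)
    {R : Type*} [CommRing R] (φ : IwasawaAlgebra p →+* R) (𝔟 : Ideal R)
    (hω : φ ((1 + PowerSeries.X : IwasawaAlgebra p) ^ (p ^ n) - 1) ∈ 𝔟) {θ t L : R}
    (hθ : θ ∈ (Module.fittingIdeal (IwasawaAlgebra p)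
      (LocNilDual (selmerOver (κ.layerSubgroup n) (W.geomPrimaryTorsion p) p 𝔭 S) f h) 0).map φ)
    (hrec : t * L ∈ Ideal.span {θ} ⊔ 𝔟) :
    φ ((p : IwasawaAlgebra p) ^ (a * G)) * (t * L) ∈
        (Module.fittingIdeal (IwasawaAlgebra p) (XAc W p κ 𝔭 S γ) 0).map φ ⊔ 𝔟 ∧
      φ ((p : IwasawaAlgebra p) ^ (a * G)) * (t * L) ∈
        (Module.fittingIdeal (IwasawaAlgebra p) (XAc W p κ 𝔭 ∅ γ) 0).map φ ⊔ 𝔟 := by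
  -- `φ(p^{aG}) · θ ∈ Fitt(X)·R + (φ ω_n) ⊆ Fitt(X)·R + 𝔟`
  have hθ' : φ ((p : IwasawaAlgebra p) ^ (a * G)) * θ ∈
      (Module.fittingIdeal (IwasawaAlgebra p) (XAc W p κ 𝔭 S γ) 0).map φ ⊔ 𝔟 := by
    have hle := Ideal.map_mono (f := φ)
      (span_pow_mul_fittingIdeal_layer_le_sup κ W 𝔭 S γ n q hqsurj hann x hx)
    rw [Ideal.map_mul, Ideal.map_sup, Ideal.map_span, Set.image_singleton, Ideal.map_span,
      Set.image_singleton, ← pow_mul] at hle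
    have h1 : φ ((p : IwasawaAlgebra p) ^ (a * G)) * θ ∈
        Ideal.span {φ ((p : IwasawaAlgebra p) ^ (a * G))} *
          (Module.fittingIdeal (IwasawaAlgebra p)
            (LocNilDual (selmerOver (κ.layerSubgroup n) (W.geomPrimaryTorsion p) p 𝔭 S) f h) 0).map φ :=
      Ideal.mul_mem_mul (Ideal.mem_span_singleton_self _) hθ
    exact (sup_le_sup_left ((Ideal.span_singleton_le_iff_mem _).mpr hω) _) (hle h1)
  -- `t · L = r θ + b`
  have hmain : φ ((p : IwasawaAlgebra p) ^ (a * G)) * (t * L) ∈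
      (Module.fittingIdeal (IwasawaAlgebra p) (XAc W p κ 𝔭 S γ) 0).map φ ⊔ 𝔟 := by
    obtain ⟨y, hy, b, hb, hyb⟩ := Submodule.mem_sup.mp hrec
    obtain ⟨r, rfl⟩ := Ideal.mem_span_singleton'.mp hy
    rw [← hyb, mul_add, ← mul_assoc, mul_comm (φ _) r, mul_assoc]
    exact Ideal.add_mem _ (Ideal.mul_mem_left _ r hθ') (Ideal.mem_sup_right (Ideal.mul_mem_left _ _ hb))
  exact ⟨hmain, (sup_le_sup_right (Ideal.map_mono
    (Summit.BirchSwinnertonDyer.BirchSwinnertonDyer.Theorems.CumulativeHeegnerInclusionAtThreeLayerControlDual.fittingIdeal_XAc_le_empty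
      κ W 𝔭 S γ)) 𝔟) hmain⟩

end Layer

end Summit.BirchSwinnertonDyer.BirchSwinnertonDyer.Theorems.CumulativeHeegnerInclusionAtThreeLayerControlFittingTransfer

end
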